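/- Fleet lead `ym-wcr-19456-p1` (seat g2), route `WeakCouplingRates`, crux `ColdBoxTwoPointFloorW` (stmt-QuantumFields-19608). -/
-- tree-module: Summits.QuantumFields.YangMills.Theorems.WeakCouplingRatesColdBoxColourCov
import Summits.QuantumFields.YangMills.Theorems.WeakCouplingRatesColdBoxGaussMoments
import Summits.QuantumFields.YangMills.Theorems.WeakCouplingRatesColdBoxTiltBound

/-!
# Crux `ColdBoxTwoPointFloorW`, stub `stub_boxGaussianDomination`, step 6 (three colours): the reference covariance of the surrogates IS
# `¾ · boxDirCircSqCov`

Under `gauss3 H = boxDirichlet H ^{⊗3}` the surrogates `qObs H p t = Σ_c ½(dirCirc H p (t c))²` are colour sums, so by `cov_colourSum_pi`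
(p447392) their connected two-point function is `3 · Cov_D(½s(p)², ½s(q)²) = ¾ · Cov_D(s(p)², s(q)²)`; at the two plaquettes of the crux this is
**`cov_qObs_gauss3_eq`: `Cov_{gauss3}(qObs p_c, qObs (p_c + Te₀)) = ¾ · boxDirCircSqCov H T`** (`= (3/2)·Π_D²` by the Dirichlet Wick identity
`boxDirCircSqCov_eq_two_mul_sq`).  No sorry; no new definition; standard axioms.  NOT a claim about the mass gap.
-/

set_option autoImplicit false

noncomputable section

open MeasureTheory ProbabilityTheory Finset
open Literature.Probability.LatticeModels (Site halfOpenBox)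
open Literature.MathematicalPhysics.QuantumLattice
open Literature.MathematicalPhysics.QuantumFieldTheory
open Literature.MathematicalPhysics.QuantumFieldTheory.LatticeMaxwell
open Literature.MathematicalPhysics.QuantumFieldTheory.AxialGauge

namespace Summit.QuantumFields.YangMills.Theorems.WeakCouplingRates

variable {H : ℕ}

/-- The surrogate as a colour sum: `qObs H p t = Σ_c ½ (dirCirc H p (t c))²`. -/
theorem qObs_eq_sum (p : Plaq 4) (t : TSpace H) : qObs H p t = ∑ c, 1 / 2 * dirCirc H p (t c) ^ 2 := by
  rw [qObs, Finset.mul_sum]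

/-- **Colour identity (general plaquettes)**: for plaquettes `p, q` with Dirichlet variances `≤ 1`,
`Cov_{gauss3}(qObs p, qObs q) = ¾ · (E_D[s(p)²s(q)²] − E_D[s(p)²]E_D[s(q)²])`. -/
theorem cov_qObs_gauss3_eq_general (p q : Plaq 4) (hp : ∫ s, dirCirc H p s ^ 2 ∂(boxDirichlet H) ≤ 1)
    (hq : ∫ s, dirCirc H q s ^ 2 ∂(boxDirichlet H) ≤ 1) :
    (∫ t, qObs H p t * qObs H q t ∂(gauss3 H)) - (∫ t, qObs H p t ∂(gauss3 H)) * (∫ t, qObs H q t ∂(gauss3 H)) =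
      3 / 4 * ((∫ s, dirCirc H p s ^ 2 * dirCirc H q s ^ 2 ∂(boxDirichlet H)) -
        (∫ s, dirCirc H p s ^ 2 ∂(boxDirichlet H)) * (∫ s, dirCirc H q s ^ 2 ∂(boxDirichlet H))) := by
  have h := cov_colourSum_pi (ι := Fin 3) (boxDirichlet H) (fun s => 1 / 2 * dirCirc H p s ^ 2) (fun s => 1 / 2 * dirCirc H q s ^ 2)
    (memLp_two_half_dirCirc_sq p hp) (memLp_two_half_dirCirc_sq q hq)
  simp only [← qObs_eq_sum] at h
  rw [gauss3, h, Fintype.card_fin]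
  have e1 : ∫ s, 1 / 2 * dirCirc H p s ^ 2 * (1 / 2 * dirCirc H q s ^ 2) ∂(boxDirichlet H) =
      1 / 4 * ∫ s, dirCirc H p s ^ 2 * dirCirc H q s ^ 2 ∂(boxDirichlet H) := by
    rw [← integral_const_mul]; refine integral_congr_ae (ae_of_all _ fun s => ?_); ring
  have e2 : ∫ s, 1 / 2 * dirCirc H p s ^ 2 ∂(boxDirichlet H) = 1 / 2 * ∫ s, dirCirc H p s ^ 2 ∂(boxDirichlet H) :=
    integral_const_mul _ _
  have e3 : ∫ s, 1 / 2 * dirCirc H q s ^ 2 ∂(boxDirichlet H) = 1 / 2 * ∫ s, dirCirc H q s ^ 2 ∂(boxDirichlet H) :=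
    integral_const_mul _ _
  rw [e1, e2, e3]
  push_cast
  ring

/-- The two plaquettes of the crux have Dirichlet variances `≤ 1` (`H ≥ 1`, `T ≤ H`). -/
theorem integral_dirCirc_sq_le_one_centre (hH : 1 ≤ H) {T : ℕ} (hT : T ≤ H) :
    ∫ s, dirCirc H (plaq12At (boxCentre H)) s ^ 2 ∂(boxDirichlet H) ≤ 1 ∧
      ∫ s, dirCirc H (plaq12At (boxCentre H + Pi.single 0 (T : ℤ))) s ^ 2 ∂(boxDirichlet H) ≤ 1 := by
  have h1 := integral_dirCirc_sq_le_one_of_touching (centre_mem_plaquettesTouching hH hT).1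
  have h2 := integral_dirCirc_sq_le_one_of_touching (centre_mem_plaquettesTouching hH hT).2
  exact ⟨h1, h2⟩

/-- **Colour identity at the crux's plaquettes**: `Cov_{gauss3}(qObs p_c, qObs (p_c + Te₀)) = ¾ · boxDirCircSqCov H T` (`H ≥ 1`, `T ≤ H`). -/
theorem cov_qObs_gauss3_eq (hH : 1 ≤ H) {T : ℕ} (hT : T ≤ H) :
    (∫ t, qObs H (plaq12At (boxCentre H)) t * qObs H (plaq12At (boxCentre H + Pi.single 0 (T : ℤ))) t ∂(gauss3 H)) -
        (∫ t, qObs H (plaq12At (boxCentre H)) t ∂(gauss3 H)) *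
          (∫ t, qObs H (plaq12At (boxCentre H + Pi.single 0 (T : ℤ))) t ∂(gauss3 H)) =
      3 / 4 * boxDirCircSqCov H T := by
  obtain ⟨hp, hq⟩ := integral_dirCirc_sq_le_one_centre hH hT
  rw [cov_qObs_gauss3_eq_general _ _ hp hq, boxDirCircSqCov]

end Summit.QuantumFields.YangMills.Theorems.WeakCouplingRates

end
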